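import Summits.QuantumFields.YangMills.Theorems.UnitScaleTiltProp7Chart47T3Sym
import Summits.QuantumFields.YangMills.Theorems.UnitScaleTiltProp8ChartDefs
import HarnessLib

/-!
# Route `UnitScaleTilt`, crux K1 child «MinimiserStabilityRegPr» (stmt-QuantumFields-19200), node (AVG-SYM) — **BRIDGE: the complexified symmetric average of
# `Prop7SymAvgGLDefs` (p599179; seat w1) IS the H-lane's unguarded (0.4) average `Prop8Chart.emlAvgU` ∕ `emlIterU` (`…Prop8ChartDefs`; LOCATED by ★w4-20520 g2,
# OWNER 02:53:57Z∕02:57:14Z — the two definitions crossed on the bus), so that the (BD)∕(AN) machinery of `Prop8Chart*` (`coe_emlIterU_unitsField(_T)`,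
# `norm_emlIterU_sub_one_le_of_reads`, `differentiableAt_coe_emlIterU_of_reads`, `emlIterU_gaugeActT`, `Prop8ChartLocality`) applies to `descendToGL`, `logChartSym`,
# `CmapSym`, `Chart47T3sym` (p599598) by rewriting; plus `logChartSym U₀ 0 = 0` and the «linear remainder» form `CmapSym = Q − Q 0 − fderiv Q 0` that ★w2-20520 g2's
# `Prop7AnalyticRemainderInputs.inputs_linRemainder_of_analyticOnNhd_of_bound` (⧗ p599231) consumes

Cell `ym3-torus` ∕ width seat `ym-ust-19200-w1` (gen 2).  YM₃ on T³ is ladder rung R3, not the Clay problem; nothing here is a claim about the crux or the gap.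

WHAT IS PROVED (sorry-free, no definition): `avgFunGL_eq_emlAvgU` (`avgFunGL = Prop8Chart.emlAvgU` at `𝔸 = M₂(ℂ)`: same loop words, `expUnit ∘ meanLog = eml` by
`ExpMeanLog.eml_eq_exp_meanLog`), `iterGL_eq_emlIterU`, `descendToGL_eq_fieldShift_emlIterU`, `logChartSym_zero` (`e^{0}·U₀ = U₀`, `log 1 = 0`), `CmapSym_eq_linRemainder`.
HONEST SCOPE: bookkeeping identities only; count-neutral (`--supports`); nothing continuum ∕ OS ∕ mass-gap ∕ Clay.

References: T. Bałaban, CMP **109** (1987) 249–301 [Balaban1987RG1] ((0.4), (0.11) p.253); CMP **102** (1985) 277–309 [Balaban1985Variational] ((44) p.285).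
-/

noncomputable section

open scoped Matrix.Norms.L2Operator

namespace Summit.QuantumFields.YangMills.Theorems.Prop7SymAvgGL

open NormedSpace
open Literature.MathematicalPhysics.QuantumFieldTheory.Balaban1983to89
open T3ContinuumYM3Torus
open T3SectALandauChart (bgUnits)
open B7Prop1Explicit (expUnit val_expUnit)
open T3LevelShift (fieldShift)
open ExpMeanLog (eml eml_eq_exp_meanLog)
open MatrixLog (mlog mlog_one)
open Summit.QuantumFields.YangMills.Theorems.Prop8Chart (emlAvgU emlIterU coe_emlAvgU loopHolU)

variable {P : Params} {j : ℕ}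

/-- **ONE STEP: `avgFunGL = emlAvgU`** (at `𝔸 = M₂(ℂ)`): the same loop variables (`loopHolGL = loopHolU`, both `holT` along `BlockAveraging.loopWord` from `emb c₋`), the
same straight transporter, and `exp ∘ meanLog = eml`. [cite: Balaban1987RG1, (0.4) p.253] -/
theorem avgFunGL_eq_emlAvgU (U : GaugeField P j (Matrix (Fin 2) (Fin 2) ℂ)ˣ) : avgFunGL U = emlAvgU U := by
  funext c
  apply Units.ext
  rw [val_avgFunGL, coe_emlAvgU, meanLogGL, ← eml_eq_exp_meanLog]
  rfl

/-- **`k` STEPS: `iterGL k = emlIterU k`.** [cite: Balaban1987RG1, (0.11) p.253] -/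
theorem iterGL_eq_emlIterU : ∀ (k : ℕ) (U : GaugeField P 0 (Matrix (Fin 2) (Fin 2) ℂ)ˣ), iterGL k U = emlIterU k U
  | 0, _ => rfl
  | k + 1, U => by
    rw [iterGL_succ, iterGL_eq_emlIterU k U, avgFunGL_eq_emlAvgU]
    rfl

/-- **THE DESCENT: `descendToGL F n K h = fieldShift ∘ emlIterU (K − n)`** — so every `Prop8Chart*` theorem about `emlIterU` reads on `descendToGL`.
[cite: Balaban1987RG1, (0.4) p.253; Balaban1985UV3, (1)–(3) p.256] -/
theorem descendToGL_eq_fieldShift_emlIterU (F : T3Family) (n K : ℕ) (h : n ≤ K) (U : GaugeField (F.P K) 0 (Matrix (Fin 2) (Fin 2) ℂ)ˣ) :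
    descendToGL F n K h U =
      fieldShift (F.sitesPerDir_eq (m := F.m) (K := n) (j := 0) (m' := F.m) (K' := K) (j' := K - n) (by omega)) (emlIterU (K - n) U) := by
  unfold descendToGL
  rw [iterGL_eq_emlIterU]

variable (F : T3Family) (n K : ℕ) (h : n ≤ K)

/-- `e^{0}·U₀ = U₀` bondwise (`exp 0 = 1`). [folklore] -/
theorem expUnit_zero_mul_bgUnits (U₀ : GaugeField (F.P K) 0 (Matrix.specialUnitaryGroup (Fin 2) ℂ)) :
    (fun b : PBond (F.P K) 0 => expUnit ((0 : PBond (F.P K) 0 → Matrix (Fin 2) (Fin 2) ℂ) b) * bgUnits F K U₀ b) = bgUnits F K U₀ := by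
  funext b
  have h1 : expUnit ((0 : PBond (F.P K) 0 → Matrix (Fin 2) (Fin 2) ℂ) b) = 1 := by
    apply Units.ext
    rw [val_expUnit, Pi.zero_apply, exp_zero, Units.val_one]
  rw [h1, one_mul]

/-- **THE LOG-CHART VANISHES AT THE ORIGIN**: `logChartSym U₀ 0 = 0` (`D̄(U₀)·D̄(U₀)⁻¹ = 1`, `log 1 = 0`) — so «`Q − Q 0 − fderiv Q 0`» of ★w2-20520's analytic-remainder
scheme is `CmapSym`. [cite: Balaban1985Variational, (44) p.285] -/
theorem logChartSym_zero (U₀ : GaugeField (F.P K) 0 (Matrix.specialUnitaryGroup (Fin 2) ℂ)) : logChartSym F n K h U₀ 0 = 0 := by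
  funext c
  show mlog (_ * _) = 0
  rw [expUnit_zero_mul_bgUnits, Units.mul_inv, mlog_one]

/-- **`CmapSym` IN THE «LINEAR REMAINDER» FORM** `A ↦ Q A − Q 0 − (fderiv ℂ Q 0) A` with `Q = logChartSym U₀` (the shape consumed by
`Prop7AnalyticRemainderInputs.inputs_linRemainder_of_analyticOnNhd_of_bound`). [cite: Balaban1985Variational, (44) p.285] -/
theorem CmapSym_eq_linRemainder (U₀ : GaugeField (F.P K) 0 (Matrix.specialUnitaryGroup (Fin 2) ℂ)) :
    CmapSym F n K h U₀ = fun A => logChartSym F n K h U₀ A - logChartSym F n K h U₀ 0 - (fderiv ℂ (logChartSym F n K h U₀) 0) A := by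
  funext A
  rw [logChartSym_zero, sub_zero]
  rfl

end Summit.QuantumFields.YangMills.Theorems.Prop7SymAvgGL

end
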